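import Mathlib
import HarnessLib
import Summits.HubbardSuperconductivity.HubbardSuperconductivity.Theorems.WeakCouplingBCSWcbcsKohnLuttingerB1gKlCertForm

/-!
# Route `WeakCouplingBCS` — support item `WcbcsKohnLuttingerB1g` (stmt-HubbardSuperconductivity-0158):
# the multiplicity-aware record checker `checkB1gD` is sound, and the μ-form WINDOW statement

`KLCert.checkB1gD` (`Theorems/WeakCouplingBCSDefs.lean`) differs from `KLCert.checkB1g` in one test: a far-channel block
of the channel `χ` is accepted when `Hhi ≤ dmult χ · s²` (`dmult E = 2`, `dmult χ = 1` otherwise) instead of `Hhi ≤ s²`.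
Soundness of the sharper `E` test: the quarter turn `rot` acts on `L²(σ_μ)` as an isometry `U₁` commuting with the kernel
operator `A` and with the sector projection `P`, and `⟪v, U₁ v⟫ = 0` on the `E` sector (`stub_klChannelOps`); hence every
negative eigenvalue `c` of the compression of `A` to the `E` sector carries an orthonormal PAIR of eigenvectors
(`doublet_of_isometry`), the deflated Hilbert–Schmidt bound gives `2c² ≤ Σ_j c_j² ≤ h` (`negSqMass_le_of_family_bound`),
so `c ≥ -√(h/2)`, i.e. `-s ≤ channelInf ε₀ μ 1 E` as soon as `h ≤ 2s²` (`klb1gd_channelFar_mult`; for the one-dimensional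
channels this is `stub_klChannelFar` verbatim).  The rest is the bookkeeping of `…KlCertForm.lean` with `lowerOKd` in
place of `lowerOK`:

* `klb1gd_rayleigh_ge_neg_of_negSqMass_le_mult` — abstract: compact self-adjoint `T`, every negative eigenvalue has an
  orthonormal `d`-family of eigenvectors, negative square mass `≤ h ≤ d s²` ⇒ `-s ‖y‖² ≤ ⟪y, Ty⟫`;
* `klb1gd_channelFar_mult`, `klb1gd_blockLower` (block level: `lowerOKd → lower ≤ channelInf`),
  `klb1gd_box_certificate`, `klb1gd_coverLogic`;
* **`klb1gd_window`** — an accepted record with certified enclosures gives, for EVERY `μ ∈ [c.mub, c.mua]` and every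
  `χ ≠ B1g`, `channelInf ε₀ μ 1 B1g + c.gamma ≤ channelInf ε₀ μ 1 χ` (the μ-uniform window statement), and
  **`klb1gd_window_U`** — the same for all `0 < U < 1` with margin `c.gamma · U²`;
* **`wcbcsKohnLuttingerB1g_of_klCertB1gD`** — `c.checkB1gD = true → c.EnclosuresB1g → WcbcsKohnLuttingerB1g`.

References: M. Reed, B. Simon, *Methods of Modern Mathematical Physics IV*, §XIII.1 (min-max), Thm. XIII.5;
S. Raghu, S. A. Kivelson, D. J. Scalapino, Phys. Rev. B 81 (2010) 224505, §II–III.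
-/

noncomputable section

-- the tree's namespace `Summit.<Summit>.<Problem>.Theorems` repeats the summit name by design (D-0017)
set_option linter.dupNamespace false

namespace Summit.HubbardSuperconductivity.HubbardSuperconductivity.Theorems

open MeasureTheory Literature.MathematicalPhysics.QuantumLattice Literature.Analysis.OperatorTheory CwKLChiralWindow
open Summit.HubbardSuperconductivity.HubbardSuperconductivity.Theses.WeakCouplingBCS
open scoped InnerProductSpace

/-! ### The abstract far-channel bound with a symmetry multiplicity -/

/-- **Far-channel bound with multiplicity.** Let `T` be a compact self-adjoint operator on a real Hilbert space such that
every negative eigenvalue `c` has an orthonormal `d`-family of eigenvectors (`d ≥ 1`), and such that every finite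
orthonormal family of eigenvectors with negative eigenvalues `c_j` has `Σ_j c_j² ≤ h`.  If `h ≤ d s²` with `s ≥ 0` then
`-s ‖y‖² ≤ ⟪y, T y⟫` for every `y`: each negative eigenvalue satisfies `d c² ≤ h ≤ d s²`, so `c ≥ -s`; expand `y` in an
eigenbasis. [cite: ReedSimonIV1978, Thm. XIII.1] -/
theorem klb1gd_rayleigh_ge_neg_of_negSqMass_le_mult {H : Type*} [NormedAddCommGroup H] [InnerProductSpace ℝ H]
    [CompleteSpace H] {T : H →L[ℝ] H} (hT : IsCompactOperator T) (hsa : IsSelfAdjoint T) {d : ℕ} (hd : 1 ≤ d)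
    (hmult : ∀ (c : ℝ) (v : H), c < 0 → v ≠ 0 → T v = c • v →
      ∃ w : Fin d → H, Orthonormal ℝ w ∧ ∀ j, T (w j) = c • w j)
    {h s : ℝ} (hs : 0 ≤ s) (hhs : h ≤ d * s ^ 2)
    (hsq : ∀ (m : ℕ) (w : Fin m → H) (c : Fin m → ℝ), Orthonormal ℝ w →
      (∀ j, c j < 0 ∧ T (w j) = c j • w j) → ∑ j, c j ^ 2 ≤ h) (y : H) :
    -s * ‖y‖ ^ 2 ≤ ⟪y, T y⟫_ℝ := by
  obtain ⟨t, b, κ, -, hTb⟩ := exists_hilbertBasis_eigenvectors_of_isSelfAdjoint hT hsa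
  have hTb' : ∀ i, T (b i) = (κ i : ℝ) • b i := fun i => by simpa using hTb i
  have hsym : ∀ x y : H, ⟪T x, y⟫_ℝ = ⟪x, T y⟫_ℝ :=
    (ContinuousLinearMap.isSelfAdjoint_iff_isSymmetric.1 hsa)
  have hdpos : (0 : ℝ) < d := by exact_mod_cast hd
  have hmin : ∀ i, -s ≤ κ i := by
    intro i
    by_cases hi : 0 ≤ κ i
    · linarith
    push Not at hi
    have hbi : (b i : H) ≠ 0 := by
      intro h0
      have := b.orthonormal.norm_eq_one i
      rw [h0, norm_zero] at this
      exact zero_ne_one this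
    obtain ⟨w, hw, hTw⟩ := hmult (κ i) (b i) hi hbi (hTb' i)
    have h1 := hsq d w (fun _ => κ i) hw (fun j => ⟨hi, hTw j⟩)
    simp only [Finset.sum_const, Finset.card_univ, Fintype.card_fin, nsmul_eq_mul] at h1
    have h2 : (d : ℝ) * κ i ^ 2 ≤ d * s ^ 2 := h1.trans hhs
    have h3 : κ i ^ 2 ≤ s ^ 2 := le_of_mul_le_mul_left h2 hdpos
    nlinarith [mul_pos (by linarith : (0 : ℝ) < -κ i) (by linarith : (0 : ℝ) < -κ i)]
  have h0 := hasSum_norm_inner_sq (𝕜 := ℝ) b y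
  have h1 := hasSum_eigen_norm_sq (𝕜 := ℝ) b hsym hTb y
  have hle : ∀ i, -s * ‖⟪b i, y⟫_ℝ‖ ^ 2 ≤ κ i * ‖⟪b i, y⟫_ℝ‖ ^ 2 := fun i =>
    mul_le_mul_of_nonneg_right (hmin i) (sq_nonneg _)
  have h2 := hasSum_le hle (h0.mul_left (-s)) h1
  simpa using h2

/-! ### The far-channel bound of a channel with its multiplicity -/

set_option maxHeartbeats 800000 in
/-- **The far-channel bound with the symmetry multiplicity** (`stub_klChannelFar` sharpened on `E`): for `μ ∈ (-4,0)`,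
a channel `χ`, the base kernel `κ = [withU] + χ₀` (`withU → χ = A1g`) and an admissible deflation with
`∫∫ (K_χ - Σ c u⊗u)² ≤ h ≤ d_χ s²`, `s ≥ 0`, `d_E = 2`, `d_χ = 1` otherwise: `-s ≤ channelInf ε₀ μ 1 χ`.  On `E` every
negative eigenvalue of the sector compression is a doublet (`doublet_of_isometry` with the quarter turn `U₁` of
`stub_klChannelOps`), so the negative square mass `≤ h` forces `2 λ_min² ≤ h`. [folklore] -/
theorem klb1gd_channelFar_mult : ∀ μ ∈ Set.Ioo (-4 : ℝ) 0, ∀ (χ : D4Irrep) (withU : Bool) (M : ℕ) (c : Fin M → ℝ)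
    (u : Fin M → Momentum → ℝ) (h s : ℝ),
    (withU = true → χ = D4Irrep.A1g) → (∀ m, 0 ≤ c m) →
    (∀ m, MemLp (u m) 2 (fermiCurveMeasure (squareDispersion 1 0) μ)) →
    ∫ z, (d4Project χ (fun q => (if withU then 1 else 0) + lindhardFunction (squareDispersion 1 0) μ (z.1 + q)) z.2 -
        ∑ m, c m * (u m z.1 * u m z.2)) ^ 2
        ∂(fermiCurveMeasure (squareDispersion 1 0) μ).prod (fermiCurveMeasure (squareDispersion 1 0) μ) ≤ h →
    0 ≤ s → h ≤ (if χ = D4Irrep.E then 2 else 1) * s ^ 2 →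
    -s ≤ channelInf (squareDispersion 1 0) μ 1 χ := by
  intro μ hμ χ withU M c u h s hU hc hu hH hs hhs
  haveI : IsFiniteMeasure (fermiCurveMeasure (squareDispersion 1 0) μ) :=
    stub_klFiniteMeasure stub_klGradient stub_klHausdorffFinite μ hμ
  obtain ⟨A, P, U₁, hA, hAinner, hAsa, hAc, hAP, -, -, -, hPfix, hPrepr, -, hAU, hPU, hUinner, hEskew, hHS, hBpos⟩ :=
    stub_klChannelOps μ hμ χ withU M c u hu hU hc
  obtain ⟨V, hmemV, hVc⟩ : ∃ V : Submodule ℝ (Lp ℝ 2 (fermiCurveMeasure (squareDispersion 1 0) μ)),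
      (∀ v, v ∈ V ↔ P v = v) ∧ CompleteSpace V :=
    ⟨_, fun v => kl_cb_mem_ker_iff P v, (ContinuousLinearMap.isClosed_ker _).completeSpace_coe⟩
  haveI : CompleteSpace V := hVc
  have hVA : ∀ v ∈ V, A v ∈ V := by
    intro v hv
    rw [hmemV] at hv ⊢
    have h1 := congrArg (fun f => f v) hAP
    simp only [mul_apply_eq_comp] at h1
    rw [hv] at h1
    exact h1.symm
  obtain ⟨T, hT, hTsa', hTc'⟩ := exists_compression A V hVA
  -- multiplicity
  obtain ⟨d, hd, hdcast, hdE, hdnE⟩ : ∃ d : ℕ, 1 ≤ d ∧ (d : ℝ) = (if χ = D4Irrep.E then 2 else 1 : ℝ) ∧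
      (χ = D4Irrep.E → d = 2) ∧ (χ ≠ D4Irrep.E → d = 1) := by
    by_cases hE : χ = D4Irrep.E
    · exact ⟨2, by norm_num, by rw [if_pos hE]; norm_num, fun _ => rfl, fun h => absurd hE h⟩
    · exact ⟨1, le_rfl, by rw [if_neg hE]; norm_num, fun h => absurd h hE, fun _ => rfl⟩
  have hmult : ∀ (c' : ℝ) (v : V), c' < 0 → v ≠ 0 → T v = (c' : ℝ) • v →
      ∃ w : Fin d → V, Orthonormal ℝ w ∧ ∀ j, T (w j) = (c' : ℝ) • w j := by
    by_cases hE : χ = D4Irrep.E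
    · rw [hdE hE]
      have hUV : ∀ v ∈ V, U₁ v ∈ V := by
        intro v hv
        rw [hmemV] at hv ⊢
        have h1 := congrArg (fun f => f v) hPU
        simp only [mul_apply_eq_comp] at h1
        rw [hv] at h1
        exact h1
      have horth : ∀ v ∈ V, inner ℝ v (U₁ v) = 0 := fun v hv => hEskew hE v ((hmemV v).1 hv)
      exact doublet_of_isometry (𝕜 := ℝ) hT hAU hUV hUinner horth
    · rw [hdnE hE]
      intro c' v _ hv hTv
      have hvn : ‖(v : Lp ℝ 2 (fermiCurveMeasure (squareDispersion 1 0) μ))‖ ≠ 0 := by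
        rw [Submodule.norm_coe]; exact norm_ne_zero_iff.2 hv
      refine ⟨![(‖(v : Lp ℝ 2 (fermiCurveMeasure (squareDispersion 1 0) μ))‖⁻¹ : ℝ) • v], ?_, ?_⟩
      · rw [orthonormal_iff_ite]
        intro i j
        fin_cases i; fin_cases j
        simp only [Fin.zero_eta, Fin.isValue, Matrix.cons_val_fin_one, ↓reduceIte]
        rw [Submodule.coe_inner, Submodule.coe_smul, real_inner_smul_left, real_inner_smul_right,
          real_inner_self_eq_norm_sq]
        field_simp
      · intro j
        fin_cases j
        simp only [Fin.zero_eta, Fin.isValue, Matrix.cons_val_fin_one, map_smul, hTv]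
        rw [smul_comm]
  -- negative square mass
  have hfam : ∀ (m : ℕ) (f : Fin m → Lp ℝ 2 (fermiCurveMeasure (squareDispersion 1 0) μ)), Orthonormal ℝ f →
      (∀ j, f j ∈ V) →
      ∑ j, ‖A (f j) - (∑ m, c m • (innerSL ℝ ((hu m).toLp (u m))).smulRight ((hu m).toLp (u m))) (f j)‖ ^ 2 ≤ h :=
    fun m f hf hfV => (hHS m f hf fun j => (hmemV _).1 (hfV j)).trans hH
  have hsq := negSqMass_le_of_family_bound (𝕜 := ℝ) hT (fun y => by simpa using hBpos y) hfam
  have hhs' : h ≤ (d : ℝ) * s ^ 2 := by rw [hdcast]; exact hhs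
  have hray : ∀ y : V, -s * ‖y‖ ^ 2 ≤ inner ℝ y (T y) := fun y =>
    klb1gd_rayleigh_ge_neg_of_negSqMass_le_mult (hTc' hAc) (hTsa' hAsa) hd hmult hs hhs'
      (fun m w c' hw hcw => hsq m w c' hw (fun j => by simpa using hcw j)) y
  -- dictionary: every channel state has pairing form `≥ -s`
  have hlow : ∀ ψ, IsChannelState (squareDispersion 1 0) μ χ ψ → -s ≤ pairingForm (squareDispersion 1 0) μ 1 ψ := by
    intro ψ hψ
    have hvae : (hψ.1.toLp ψ : Momentum → ℝ) =ᵐ[fermiCurveMeasure (squareDispersion 1 0) μ] ψ := hψ.1.coeFn_toLp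
    have hvV : P (hψ.1.toLp ψ) = hψ.1.toLp ψ := hPfix ψ hψ.1 hψ.2.2
    have hvnorm : ‖hψ.1.toLp ψ‖ = 1 := by
      have h2 : ‖hψ.1.toLp ψ‖ ^ 2 = 1 := by rw [kl_bs_norm_sq_eq_integral_of_ae_eq hvae, hψ.2.1]
      exact (pow_eq_one_iff_of_nonneg (norm_nonneg _) two_ne_zero).1 h2
    have h1 := hray ⟨hψ.1.toLp ψ, (hmemV _).2 hvV⟩
    rw [(compression_inner_norm hT _).1] at h1
    change -s * ‖hψ.1.toLp ψ‖ ^ 2 ≤ inner ℝ (hψ.1.toLp ψ) (A (hψ.1.toLp ψ)) at h1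
    rw [hvnorm, one_pow, mul_one, kl_bs_inner_eq_of_ae_eq
      (fun q => (if withU then 1 else 0) + lindhardFunction (squareDispersion 1 0) μ q) A hAinner hvae] at h1
    exact h1.trans (kl_cb_pairingForm_ge hμ hU hψ).1
  have hne : ((pairingForm (squareDispersion 1 0) μ 1) '' {ψ | IsChannelState (squareDispersion 1 0) μ χ ψ}).Nonempty :=
    (nonempty_isChannelState hμ.1 hμ.2 χ).image _
  exact le_csInf hne (by rintro r ⟨ψ, hψ, rfl⟩; exact hlow ψ hψ)

/-! ### Block level: the multiplicity-aware far test is sound -/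

/-- **Far-channel bound of a block, multiplicity-aware test.** If the checker accepts `farOKd` for the block in the
channel `χ` and the block enclosures hold at `μ ∈ (-4,0)`, then `-s ≤ channelInf ε₀ μ 1 χ` (`klb1gd_channelFar_mult` with
the block's deflation list, `h = Hhi`). [folklore] -/
theorem klb1gd_bkb_far {μ : ℝ} (hμ : μ ∈ Set.Ioo (-4 : ℝ) 0) (b : KLBlock) (tab : List KLTrig) (χ : D4Irrep)
    (hF : b.farOKd tab χ = true) (hE : b.Enclosure tab μ χ) :
    -(b.s : ℝ) ≤ channelInf (squareDispersion 1 0) μ 1 χ := by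
  have hF' := hF
  simp only [KLBlock.farOKd, Bool.and_eq_true, decide_eq_true_eq] at hF'
  obtain ⟨⟨⟨hdefl, hs⟩, hHs⟩, hwu⟩ := hF'
  have hHs' : (b.Hhi : ℝ) ≤ (if χ = D4Irrep.E then 2 else 1) * (b.s : ℝ) ^ 2 := by
    have h := (Rat.cast_le (K := ℝ)).2 hHs
    unfold KLBlock.dmult at h
    split_ifs at h ⊢ <;> push_cast at h <;> linarith
  exact klb1gd_channelFar_mult μ hμ χ b.withU b.defl.length (fun m => ((b.defl[(m : ℕ)].1 : ℚ) : ℝ))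
    (fun m => (klTab tab b.defl[(m : ℕ)].2).toFun) (b.Hhi : ℝ) (b.s : ℝ) (kl_bkb_withU hwu)
    (kl_bkb_defl_nonneg hdefl) (fun m => kl_tr_toFun_memLp _ hμ) ((kl_bkb_sqmass_eq b tab μ χ).trans_le hE.2)
    (by exact_mod_cast hs) hHs'

/-- **Block-level soundness of the multiplicity-aware lower-bound test**: `lowerOKd → lower ≤ channelInf ε₀ μ 1 χ`
(Temple's value if `templeOK`, `stub_klBlockBounds`; else `-s`, `klb1gd_bkb_far`). [folklore] -/
theorem klb1gd_blockLower {μ : ℝ} (hμ : μ ∈ Set.Ioo (-4 : ℝ) 0) (b : KLBlock) (tab : List KLTrig) (χ : D4Irrep)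
    (hE : b.Enclosure tab μ χ) (hL : b.lowerOKd tab χ = true) :
    ((b.lower tab χ : ℚ) : ℝ) ≤ channelInf (squareDispersion 1 0) μ 1 χ := by
  cases hT : b.templeOK tab χ with
  | true =>
    have hok : b.lowerOK tab χ = true := by simp [KLBlock.lowerOK, hT]
    exact (stub_klBlockBounds μ hμ b tab χ hE).1 hok
  | false =>
    have hF : b.farOKd tab χ = true := by simpa [KLBlock.lowerOKd, hT] using hL
    simp only [KLBlock.lower, hT, Bool.false_eq_true, ↓reduceIte]
    push_cast
    exact klb1gd_bkb_far hμ b tab χ hF hE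

/-! ### Boxes, cover, window, item -/

/-- **One box.** If a box passes `basicOKB1gD` and `b1gLeadsOK γ`, then at every `μ` of the box where the Ritz enclosures
of the `B1g` block and the block enclosures of the four other channels hold,
`channelInf ε₀ μ 1 B1g + γ ≤ channelInf ε₀ μ 1 χ` for `χ ≠ B1g`. [folklore] -/
theorem klb1gd_box_certificate {μ : ℝ} (bx : KLBox) (tab : List KLTrig) (γ : ℚ)
    (hB : bx.basicOKB1gD tab = true) (hL : bx.b1gLeadsOK tab γ = true)
    (hμ : μ ∈ Set.Icc ((bx.mulo : ℚ) : ℝ) ((bx.muhi : ℚ) : ℝ))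
    (hER : bx.bB1g.RitzEnclosure tab μ) (hE : ∀ χ : D4Irrep, χ ≠ D4Irrep.B1g → (bx.blk χ).Enclosure tab μ χ) :
    ∀ χ : D4Irrep, χ ≠ D4Irrep.B1g →
      channelInf (squareDispersion 1 0) μ 1 D4Irrep.B1g + ((γ : ℚ) : ℝ) ≤ channelInf (squareDispersion 1 0) μ 1 χ := by
  have hB' := hB
  simp only [KLBox.basicOKB1gD, Bool.and_eq_true, decide_eq_true_eq] at hB'
  obtain ⟨⟨⟨⟨⟨⟨⟨h4, -⟩, h0⟩, hritz⟩, hA1⟩, hA2⟩, hB2⟩, hEE⟩ := hB'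
  have hμ' : μ ∈ Set.Ioo (-4 : ℝ) 0 :=
    ⟨lt_of_lt_of_le (by exact_mod_cast h4) hμ.1, lt_of_le_of_lt hμ.2 (by exact_mod_cast h0)⟩
  have hup : channelInf (squareDispersion 1 0) μ 1 D4Irrep.B1g ≤ ((bx.bB1g.upper : ℚ) : ℝ) :=
    klb1g_ritz_upper hμ' bx.bB1g tab D4Irrep.B1g hritz (Or.inr (by decide)) hER
  have hL' := hL
  simp only [KLBox.b1gLeadsOK, Bool.and_eq_true, decide_eq_true_eq] at hL'
  obtain ⟨⟨⟨hlA1, hlA2⟩, hlB2⟩, hlE⟩ := hL'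
  have key : ∀ (χ : D4Irrep) (b : KLBlock), χ ≠ D4Irrep.B1g → bx.blk χ = b → b.lowerOKd tab χ = true →
      bx.bB1g.upper + γ ≤ b.lower tab χ →
      channelInf (squareDispersion 1 0) μ 1 D4Irrep.B1g + ((γ : ℚ) : ℝ) ≤ channelInf (squareDispersion 1 0) μ 1 χ := by
    intro χ b hχ hb hok hle
    have h2 := klb1gd_blockLower hμ' b tab χ (hb ▸ hE χ hχ) hok
    have h3 : ((bx.bB1g.upper : ℚ) : ℝ) + ((γ : ℚ) : ℝ) ≤ ((b.lower tab χ : ℚ) : ℝ) := by exact_mod_cast hle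
    linarith
  intro χ hχ
  cases χ with
  | A1g => exact key .A1g bx.bA1g (by decide) rfl hA1 hlA1
  | A2g => exact key .A2g bx.bA2g (by decide) rfl hA2 hlA2
  | B1g => exact absurd rfl hχ
  | B2g => exact key .B2g bx.bB2g (by decide) rfl hB2 hlB2
  | E => exact key .E bx.bE (by decide) rfl hEE hlE

/-- **Cover logic of `checkB1gD`.** An accepted record has window ends `-4 < mub < mua < 0`, `gamma > 0`, every box
passes `basicOKB1gD ∧ b1gLeadsOK gamma`, and every real `μ ∈ [mub, mua]` lies in some box. [folklore] -/
theorem klb1gd_coverLogic (c : KLCert) (hc : c.checkB1gD = true) :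
    (-4 < c.mub ∧ c.mub < c.mua ∧ c.mua < 0 ∧ 0 < c.gamma) ∧
    (∀ bx ∈ c.boxes, bx.basicOKB1gD c.trials = true ∧ bx.b1gLeadsOK c.trials c.gamma = true) ∧
    (∀ μ : ℝ, ((c.mub : ℚ) : ℝ) ≤ μ → μ ≤ ((c.mua : ℚ) : ℝ) →
      ∃ bx ∈ c.boxes, ((bx.mulo : ℚ) : ℝ) ≤ μ ∧ μ ≤ ((bx.muhi : ℚ) : ℝ)) := by
  unfold KLCert.checkB1gD at hc
  simp only [Bool.and_eq_true, decide_eq_true_eq] at hc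
  obtain ⟨⟨⟨⟨⟨⟨h₁, h₂⟩, h₃⟩, h₄⟩, hmatch⟩, hchain⟩, hall⟩ := hc
  refine ⟨⟨h₁, h₂, h₃, h₄⟩, ?_, ?_⟩
  · intro bx hbx
    have h := List.all_eq_true.1 hall bx hbx
    simp only [Bool.and_eq_true] at h
    exact ⟨h.1, h.2⟩
  · intro μ hμ₁ hμ₂
    split at hmatch
    · rename_i b₀ b₁ hb₀ hb₁
      simp only [Bool.and_eq_true, decide_eq_true_eq] at hmatch
      obtain ⟨L, hL⟩ := List.head?_eq_some_iff.1 hb₀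
      rw [hL] at hchain hb₁ ⊢
      have hlo : ((b₀.mulo : ℚ) : ℝ) ≤ μ := le_trans (by exact_mod_cast hmatch.1) hμ₁
      have hhi : μ ≤ ((b₁.muhi : ℚ) : ℝ) := le_trans hμ₂ (by exact_mod_cast hmatch.2)
      exact kl_cvl_chain_cover L b₀ b₁ hchain hb₁ μ hlo hhi
    · exact absurd hmatch Bool.false_ne_true

/-- **The μ-uniform WINDOW statement from an accepted record with certified enclosures**: for every chemical
potential `μ ∈ [c.mub, c.mua]` and every channel `χ ≠ B1g`, `channelInf ε₀ μ 1 B1g + c.gamma ≤ channelInf ε₀ μ 1 χ` — the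
`B1g` (`d_{x²-y²}`) bottom of the second-order Kohn–Luttinger vertex lies by `gamma` strictly below the four other
channel bottoms, uniformly on the window. [cite: RaghuKivelsonScalapino2010, §III Fig. 2] -/
theorem klb1gd_window (c : KLCert) (hc : c.checkB1gD = true) (hE : c.EnclosuresB1g) :
    ∀ μ ∈ Set.Icc ((c.mub : ℚ) : ℝ) ((c.mua : ℚ) : ℝ), ∀ χ : D4Irrep, χ ≠ D4Irrep.B1g →
      channelInf (squareDispersion 1 0) μ 1 D4Irrep.B1g + ((c.gamma : ℚ) : ℝ) ≤
        channelInf (squareDispersion 1 0) μ 1 χ := by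
  obtain ⟨-, hboxes, hcover⟩ := klb1gd_coverLogic c hc
  intro μ hμ χ hχ
  obtain ⟨bx, hbx, hlo, hhi⟩ := hcover μ hμ.1 hμ.2
  obtain ⟨hB, hL⟩ := hboxes bx hbx
  obtain ⟨hER, hEχ⟩ := hE bx hbx μ ⟨hlo, hhi⟩
  exact klb1gd_box_certificate bx c.trials c.gamma hB hL ⟨hlo, hhi⟩ hER hEχ χ hχ

/-- **The window statement at every weak coupling**: for `μ ∈ [c.mub, c.mua]`, `0 < U < 1` and `χ ≠ B1g`,
`channelInf ε₀ μ U B1g + c.gamma · U² ≤ channelInf ε₀ μ U χ` (`U²`-homogeneity of the `B1g` bottom — `B1g` states have mean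
zero — and the bare-`U` penalty `U² Λ₁(χ) ≤ Λ_U(χ)`, both theorems of the tree). [cite: RaghuKivelsonScalapino2010, §II (7), (13)] -/
theorem klb1gd_window_U (c : KLCert) (hc : c.checkB1gD = true) (hE : c.EnclosuresB1g) :
    ∀ μ ∈ Set.Icc ((c.mub : ℚ) : ℝ) ((c.mua : ℚ) : ℝ), ∀ U ∈ Set.Ioo (0 : ℝ) 1, ∀ χ : D4Irrep, χ ≠ D4Irrep.B1g →
      channelInf (squareDispersion 1 0) μ U D4Irrep.B1g + ((c.gamma : ℚ) : ℝ) * U ^ 2 ≤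
        channelInf (squareDispersion 1 0) μ U χ := by
  obtain ⟨⟨h4, -, h0, -⟩, -, -⟩ := klb1gd_coverLogic c hc
  intro μ hμ U hU χ hχ
  have hmo : μ ∈ Set.Ioo (-4 : ℝ) 0 :=
    ⟨lt_of_lt_of_le (by exact_mod_cast h4) hμ.1, lt_of_le_of_lt hμ.2 (by exact_mod_cast h0)⟩
  have hK := stub_klKernelHS
  have hfin : IsFiniteMeasure (fermiCurveMeasure (squareDispersion 1 0) μ) :=
    stub_klFiniteMeasure stub_klGradient stub_klHausdorffFinite μ hmo
  have hinv := stub_klD4Invariant stub_klGradient μ hmo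
  have hhom : channelInf (squareDispersion 1 0) μ U D4Irrep.B1g =
      U ^ 2 * channelInf (squareDispersion 1 0) μ 1 D4Irrep.B1g :=
    klhs_channelInf_sq hK hmo U D4Irrep.B1g
      (fun ψ hψ => (stub_klMeanZero _ _ hfin hinv D4Irrep.B1g ψ (by decide) hψ).2)
  have hpen : U ^ 2 * channelInf (squareDispersion 1 0) μ 1 χ ≤ channelInf (squareDispersion 1 0) μ U χ :=
    klhs_sq_channelInf_one_le hK hmo hU.1 hU.2.le χ
  have h1 := mul_le_mul_of_nonneg_left (klb1gd_window c hc hE μ hμ χ hχ) (sq_nonneg U)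
  rw [hhom]
  nlinarith

/-- **`WcbcsKohnLuttingerB1g` from a record accepted by the multiplicity-aware checker, with certified enclosures**
(window `[c.mub, c.mua]`, margin `γ = c.gamma`, `U₁ = 1`). [cite: RaghuKivelsonScalapino2010, §III Fig. 2] -/
theorem wcbcsKohnLuttingerB1g_of_klCertB1gD (c : KLCert) (hc : c.checkB1gD = true) (hE : c.EnclosuresB1g) :
    WcbcsKohnLuttingerB1g := by
  obtain ⟨⟨h4, h12, h0, hγ⟩, -, -⟩ := klb1gd_coverLogic c hc
  exact wcbcsKohnLuttingerB1g_of_one_certificate (μ₁ := ((c.mua : ℚ) : ℝ)) (μ₂ := ((c.mub : ℚ) : ℝ))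
    (γ := ((c.gamma : ℚ) : ℝ)) (by exact_mod_cast h4) (by exact_mod_cast h12) (by exact_mod_cast h0)
    (by exact_mod_cast hγ) (klb1gd_window c hc hE)

end Summit.HubbardSuperconductivity.HubbardSuperconductivity.Theorems

end
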